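import Summits.FinalStateConjecture.FinalStateConjecture.Theorems.BartnikGapSettlingBondiBartnikRigidityMarchingLemmaChartData
import Literature.Geometry.Lorentzian.KerrSchildTimeTranslation
import HarnessLib

/-!
# K2b-5 `stub_marchingLemma`, brick 12: agreement of two exact charts along vertical segments — line
# `direct-method-on-the-cone` (crux `BondiBartnikRigidity`, stmt-FinalStateConjecture-10807)

The step "Θ = Ψ_E on K ∩ F" of the marching (report K2b-a2 §4): two exact charts `Ψ₁` (on `pullK Q₁`)
and `Ψ₂` (on `pullK Q₂ ⊇ pullK F`) which agree on `Q₁ ∩ F ∩ {t* < τ}` agree on all of `Q₁ ∩ F`, provided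
`Q₁ ∩ F` contains, with every point `z` of Kerr time `≥ τ`, the vertical coordinate segment
`{(t', ẑ) : σ ≤ t' ≤ t*(z)}` for some `σ < τ` (in the marching: `Q₁` the kite over the level `σ`, `F` the
collar set, vertically closed).  Proof (`agree_of_vertical`): the set of heights `t'` at which the charts
agree NEAR `(t', ẑ)` is open, contains `[σ, τ)`, and is closed in `[σ, t*(z)]` by the unique continuation
of exact charts `K2Route.ExactChartGluing` applied to a small coordinate ball (connected) around the
limit point; connectedness of the segment.

References: Dafermos–Rodnianski arXiv:0811.0354, §5.1 [DafermosRodnianski2008]; O'Neill 1983, Ch. 3,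
Prop. 3.62 [ONeill1983].  No definitions, no named facts.
-/

noncomputable section

-- D-0017: single-problem summit, `Summit.<S>.<S>.…` by design (cf. lakefile `weak.linter.dupNamespace`).
set_option linter.dupNamespace false
set_option maxSynthPendingDepth 3

open Set Filter Function Topology TopologicalSpace Bundle Metric
open Literature.Geometry.Lorentzian
open scoped Manifold ContDiff Topology ENNReal

namespace Summit.FinalStateConjecture.FinalStateConjecture.Theorems.BondiBartnikRigidity.DirectMethod

namespace AgreeVertical

open ChartData (lab_mem_pullK_iff)
open F1Route (lab_poincareInv)

variable [Kerr.Facts] {𝒮 : Spacetime.{0} 4} {mo : lorentzGroup × E4} {M a : ℝ} {B : ModelBackground}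

omit [Kerr.Facts] in
/-- Small coordinate balls of the chart are open connected Kerr-side sets. [folklore] -/
theorem isConnected_coordBall (p : Kerr.region a M) :
    ∃ ε₀ > 0, ∀ ε, 0 < ε → ε ≤ ε₀ → IsOpen (ball p ε) ∧ IsConnected (ball p ε) := by
  obtain ⟨ε₀, hε₀, hball⟩ := Metric.isOpen_iff.1 (Kerr.region a M).2 p.1 p.2
  refine ⟨ε₀, hε₀, fun ε hε hle => ⟨isOpen_ball, ?_⟩⟩
  have hpre : (ball p ε : Set (Kerr.region a M)) = Subtype.val ⁻¹' ball p.1 ε := rfl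
  have himg : Subtype.val '' (ball p ε : Set (Kerr.region a M)) = ball p.1 ε := by
    rw [hpre, image_preimage_eq_inter_range, Subtype.range_coe]
    exact inter_eq_left.2 ((ball_subset_ball hle).trans hball)
  refine ⟨⟨p, mem_ball_self hε⟩, ?_⟩
  have h := (convex_ball p.1 ε).isPreconnected
  rw [← himg] at h
  exact IsInducing.subtypeVal.isPreconnected_image.1 h

/-- **Agreement of two exact charts along vertical segments** (see the module docstring).
[cite: DafermosRodnianski2008, §5.1] -/
theorem agree_of_vertical (hglue : K2Route.ExactChartGluing) (hM : 0 < M) (ha : |a| < M)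
    {lab : Kerr.region a M → B.domain} (hlab : ∀ z, (lab z : E4) = (mo.1 : E4 ≃L[ℝ] E4) z.1 + mo.2)
    (hB : B = starBackground mo.1 mo.2 M a (fun x => Kerr.radius a (poincareInv mo.1 mo.2 x)))
    {Q₁ Q₂ F : Set (Kerr.region a M)} (hQ₁ : IsOpen Q₁) (hF : IsOpen F) (hFQ₂ : F ⊆ Q₂)
    {Ψ₁ Ψ₂ : B.domain → 𝒮.carrier}
    (hs₁ : ContMDiffOn 𝓘(ℝ, E4) (𝓡 4) ∞ Ψ₁ (pullK mo M a B Q₁))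
    (hd₁ : supCkENorm (Subtype.val '' pullK mo M a B Q₁) 0 (𝒮.deviationExtend B Ψ₁) ≤ 0)
    (hs₂ : ContMDiffOn 𝓘(ℝ, E4) (𝓡 4) ∞ Ψ₂ (pullK mo M a B Q₂))
    (hd₂ : supCkENorm (Subtype.val '' pullK mo M a B Q₂) 0 (𝒮.deviationExtend B Ψ₂) ≤ 0)
    {σ τ : ℝ} (hστ : σ < τ)
    (hvert : ∀ z ∈ Q₁ ∩ F, τ ≤ z.1 0 → ∀ t' ∈ Icc σ (z.1 0),
      (⟨z.1 + (t' - z.1 0) • E4.basisVector 0, Kerr.add_smul_basisVector_zero_mem_region z.2 _⟩ :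
        Kerr.region a M) ∈ Q₁ ∩ F)
    (hagree₀ : ∀ z ∈ Q₁ ∩ F, z.1 0 < τ → Ψ₁ (lab z) = Ψ₂ (lab z)) :
    ∀ z ∈ Q₁ ∩ F, Ψ₁ (lab z) = Ψ₂ (lab z) := by
  intro z hz
  rcases lt_or_ge (z.1 0) τ with hlt | hτz
  · exact hagree₀ z hz hlt
  -- the vertical segment below `z`
  set V : ℝ → Kerr.region a M := fun t' =>
    ⟨z.1 + (t' - z.1 0) • E4.basisVector 0, Kerr.add_smul_basisVector_zero_mem_region z.2 _⟩ with hV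
  have hVc : Continuous V :=
    (continuous_const.add ((continuous_id.sub continuous_const).smul continuous_const)).subtype_mk _
  have hVt : ∀ t', (V t').1 0 = t' := fun t' => by simp [hV]
  have hVz : V (z.1 0) = z := Subtype.ext (by simp [hV])
  have hVdist : ∀ t' t'', dist (V t') (V t'') = |t' - t''| := by
    intro t' t''
    rw [Subtype.dist_eq, dist_eq_norm]
    show ‖(z.1 + (t' - z.1 0) • E4.basisVector 0) - (z.1 + (t'' - z.1 0) • E4.basisVector 0)‖ = _
    rw [show (z.1 + (t' - z.1 0) • E4.basisVector 0) - (z.1 + (t'' - z.1 0) • E4.basisVector 0) =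
      (t' - t'') • E4.basisVector 0 by module, norm_smul, Real.norm_eq_abs]
    simp [E4.basisVector]
  -- the set of heights with LOCAL agreement
  set A : Set ℝ := {t' | ∃ G : Set (Kerr.region a M), IsOpen G ∧ V t' ∈ G ∧ G ⊆ Q₁ ∩ F ∧
    ∀ y ∈ G, Ψ₁ (lab y) = Ψ₂ (lab y)} with hA
  have hAo : IsOpen A := by
    rw [isOpen_iff_mem_nhds]
    rintro t' ⟨G, hGo, hVG, hGsub, hGagree⟩
    filter_upwards [hVc.continuousAt.preimage_mem_nhds (hGo.mem_nhds hVG)] with t'' ht''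
    exact ⟨G, hGo, ht'', hGsub, hGagree⟩
  -- `σ ∈ A`
  have hσA : σ ∈ A := by
    refine ⟨Q₁ ∩ F ∩ {y | y.1 0 < τ}, (hQ₁.inter hF).inter (isOpen_lt (K2Route.continuous_tstar a M)
      continuous_const), ⟨hvert z hz hτz σ ⟨le_rfl, hστ.le.trans hτz⟩, by show (V σ).1 0 < τ; rw [hVt]; exact hστ⟩,
      inter_subset_left, fun y hy => hagree₀ y hy.1 hy.2⟩
  -- closure points of `A` in the segment are in `A` (unique continuation on a small ball)
  have hcl : closure A ∩ Icc σ (z.1 0) ⊆ A := by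
    rintro t₀ ⟨ht₀A, ht₀I⟩
    have hp : V t₀ ∈ Q₁ ∩ F := hvert z hz hτz t₀ ht₀I
    obtain ⟨ε₀, hε₀, hballs⟩ := isConnected_coordBall (V t₀)
    obtain ⟨ε₁, hε₁, hε₁sub⟩ := Metric.isOpen_iff.1 ((hQ₁.inter hF).preimage continuous_id) (V t₀) hp
    set ε := min ε₀ ε₁ with hε
    have hεp : 0 < ε := lt_min hε₀ hε₁
    set Bε : Set (Kerr.region a M) := ball (V t₀) ε with hBε
    obtain ⟨hBo, hBc⟩ := hballs ε hεp (min_le_left _ _)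
    have hBsub : Bε ⊆ Q₁ ∩ F := fun y hy => hε₁sub ((ball_subset_ball (min_le_right _ _)) hy)
    -- a height of `A` within `ε` of `t₀`
    obtain ⟨t₁, ht₁A, ht₁d⟩ : ∃ t₁ ∈ A, dist t₁ t₀ < ε := by
      have := Metric.mem_closure_iff.1 ht₀A ε hεp
      obtain ⟨t₁, ht₁A, hd⟩ := this
      exact ⟨t₁, ht₁A, by rw [dist_comm]; exact hd⟩
    obtain ⟨G, hGo, hVG, hGsub, hGagree⟩ := ht₁A
    have hVt₁B : V t₁ ∈ Bε := by
      show dist (V t₁) (V t₀) < ε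
      rw [hVdist]; rwa [Real.dist_eq] at ht₁d
    -- unique continuation from `G ∩ Bε` to `Bε`
    have key := hglue 𝒮 M a mo B Ψ₁ Ψ₂ Bε Bε (G ∩ Bε) hM ha hB hBo hBo (by rw [inter_self]; exact hBc)
      (hGo.inter hBo) ⟨V t₁, hVG, hVt₁B⟩ (by rw [inter_self]; exact inter_subset_right)
      (hs₁.mono (pullK_mono _ _ _ _ fun y hy => (hBsub hy).1))
      ((supCkENorm_mono (image_mono (pullK_mono _ _ _ _ fun y hy => (hBsub hy).1)) _ _).trans hd₁)
      (hs₂.mono (pullK_mono _ _ _ _ fun y hy => hFQ₂ (hBsub hy).2))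
      ((supCkENorm_mono (image_mono (pullK_mono _ _ _ _ fun y hy => hFQ₂ (hBsub hy).2)) _ _).trans hd₂)
      (by
        rintro x ⟨hreg, hxG, -⟩
        have hx : lab ⟨poincareInv mo.1 mo.2 x.1, hreg⟩ = x :=
          Subtype.ext (by rw [hlab]; exact lab_poincareInv mo x.1)
        rw [← hx]; exact hGagree _ hxG)
    refine ⟨Bε, hBo, mem_ball_self hεp, hBsub, fun y hy => ?_⟩
    exact key (lab y) ((lab_mem_pullK_iff hlab y).2 ⟨hy, hy⟩)
  -- connectedness of the segment
  have hsub : Icc σ (z.1 0) ⊆ A :=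
    isPreconnected_Icc.subset_of_closure_inter_subset hAo ⟨σ, ⟨le_rfl, hστ.le.trans hτz⟩, hσA⟩ hcl
  obtain ⟨G, -, hVG, -, hGagree⟩ := hsub ⟨hστ.le.trans hτz, le_rfl⟩
  rw [hVz] at hVG
  exact hGagree z hVG

end AgreeVertical

/-- **Registered bookkeeping sub-goal `stub_kerrCoordBallConnected` of the line** (brick of the landing of
K2b-5 `stub_marchingLemma`): small coordinate balls of the Kerr star chart are open and connected (anchor
of this file, whose content is the agreement of exact charts along vertical segments,
`AgreeVertical.agree_of_vertical`). [folklore] -/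
theorem stub_kerrCoordBallConnected : ∀ (M a : ℝ) (p : Kerr.region a M), ∃ ε₀ > 0, ∀ ε, 0 < ε → ε ≤ ε₀ →
    IsOpen (Metric.ball p ε) ∧ IsConnected (Metric.ball p ε) :=
  fun _ _ p => AgreeVertical.isConnected_coordBall p

end Summit.FinalStateConjecture.FinalStateConjecture.Theorems.BondiBartnikRigidity.DirectMethod

end
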